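import Summits.ValiantsHypothesis.ValiantsHypothesis.Theorems.LacunarySymmetroidMatrixDescartesGraftBorderToolkit

/-!
# `MatrixDescartes` census — THE BORDERING LAW: one more row/column buys `#letters − 1` more alternations

HONEST FRAMING.  Object-search cell `pub-symmetroid`, crux `Theses.LacunarySymmetroid.MatrixDescartes`
(stmt-ValiantsHypothesis-18050); seat val-sym-mdr-p1 (g3).  LOWER-bound / construction mathematics in census (CONJECTURE-A) currency —
the twin of the seat's GRAFT LAW (`…GraftLaw.lean`: one more LETTER buys `m` more alternations): here the format grows in `m`.  It proves
nothing about the crux `MatrixDescartes` (an upper bound at fat formats), `DoorA26` / `DoorA34`, or `VP ≠ VNP`.  No definitions.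

THE BORDERING STEP (`exists_alternating_border`).  From an alternation certificate with `K+1` letters on a STRICTLY INCREASING support `d`
(real symmetric `m × m` letters, `N` alternations along positive test points ending at `x₀`, nonvanishing determinants) an alternation
certificate with the SAME support, size `m + 1` and `N + K` alternations: border every letter by the `1 × 1` block `c_l`, where
`∑ l, y^(d l) c_l` is the generalised Vandermonde determinant with nodes `(y, r_0, …, r_{K−1})`, `r_i = x₀ + (2i+1)η` — a `K+1`-nomial on
the support `d` vanishing exactly (and simply) at the `r_i`, of sign `(−1)^c` on the `c`-th gap (toolkit `genVandermonde_cons_sign`, from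
Literature `det_genVandermonde_pos`).  The bordered determinant is `det F(y) · ∑ l, y^(d l) c_l` (block-diagonal); `det F` keeps its sign on
`[x₀, x₀ + ε) ∋ r_i` (continuity), so the new test points `x₀ + 2cη` (`c = 1, …, K`) add `K` alternations and the old ones persist (there the
fewnomial is positive).  Exact — no limits.  In census words **ζ(m+1, K+1) ≥ ζ_alt(m, K+1) + K** on strictly increasing supports
(`exists_alternating_border_add`: `+i` rows ⇒ `+i·K`).  [folklore] throughout.
-/

-- `Summit.ValiantsHypothesis.ValiantsHypothesis.…` repeats a component by the D-0017 layout
-- (single-conjunct summit), which the `dupNamespace` linter flags; the name is mandated.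
set_option linter.dupNamespace false

namespace Summit.ValiantsHypothesis.ValiantsHypothesis.Theorems.LacunarySymmetroidMatrixDescartes.Census.Graft

open Matrix Finset Filter Topology
open scoped BigOperators
open Literature.LinearAlgebra.Matrix.GeneralizedVandermonde (genVandermonde genVandermonde_apply det_genVandermonde_pos)

/-- **THE BORDERING STEP (strictly increasing support).**  Certificate `(m, K+1 letters, N)` ⇒ certificate `(m+1, K+1 letters, N+K)` on the
same support. [folklore] -/
theorem exists_alternating_border {m K N : ℕ} (d : Fin (K + 1) → ℕ) (hd : StrictMono d)
    (S : Fin (K + 1) → Matrix (Fin m) (Fin m) ℝ) (hS : ∀ l, (S l).IsSymm)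
    (τ : Fin (N + 1) → ℝ) (hτ : StrictMono τ) (hpos : ∀ j, 0 < τ j)
    (hne : ∀ j, (∑ l, τ j ^ d l • S l).det ≠ 0)
    (halt : ∀ j : Fin N, (∑ l, τ j.castSucc ^ d l • S l).det * (∑ l, τ j.succ ^ d l • S l).det < 0) :
    ∃ (S' : Fin (K + 1) → Matrix (Fin (m + 1)) (Fin (m + 1)) ℝ) (τ' : Fin (N + K + 1) → ℝ),
      (∀ l, (S' l).IsSymm) ∧ StrictMono τ' ∧ (∀ j, 0 < τ' j) ∧
      (∀ j, (∑ l, τ' j ^ d l • S' l).det ≠ 0) ∧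
      ∀ j : Fin (N + K), (∑ l, τ' j.castSucc ^ d l • S' l).det * (∑ l, τ' j.succ ^ d l • S' l).det < 0 := by
  classical
  -- the last test point; `det F` keeps its sign near it
  set x₀ : ℝ := τ (Fin.last N) with hx₀
  have hx₀pos : 0 < x₀ := hpos _
  set Δ : ℝ := (∑ l, x₀ ^ d l • S l).det with hΔ
  have hΔne : Δ ≠ 0 := hne (Fin.last N)
  have hcont : Continuous fun y : ℝ => (∑ l, y ^ d l • S l).det := by
    simpa only [Matrix.submatrix_id_id] using continuous_det_submatrix_pencil d S (id : Fin m → Fin m)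
  have hnear : ∀ᶠ y in 𝓝 x₀, 0 < (∑ l, y ^ d l • S l).det * Δ :=
    eventually_mul_pos_of_tendsto (hcont.tendsto x₀) hΔne
  obtain ⟨ε, hε, hball⟩ := Metric.eventually_nhds_iff.mp hnear
  -- scales, nodes, the fewnomial coefficients
  set η : ℝ := ε / (2 * K + 2) with hη
  have hηpos : 0 < η := by rw [hη]; positivity
  have h2Kη : 2 * (K : ℝ) * η < ε := by
    rw [hη, show 2 * (K : ℝ) * (ε / (2 * K + 2)) = ε * (2 * K) / (2 * K + 2) by ring,
      div_lt_iff₀ (by positivity)]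
    nlinarith
  set r : Fin K → ℝ := fun i => x₀ + (2 * ((i : ℕ) : ℝ) + 1) * η with hr
  have hrgt : ∀ i, x₀ < r i := fun i => by
    show x₀ < x₀ + (2 * ((i : ℕ) : ℝ) + 1) * η
    have : 0 < (2 * ((i : ℕ) : ℝ) + 1) * η := by positivity
    linarith
  have hrpos : ∀ i, 0 < r i := fun i => hx₀pos.trans (hrgt i)
  have hrmono : StrictMono r := by
    intro i j hij
    show x₀ + (2 * ((i : ℕ) : ℝ) + 1) * η < x₀ + (2 * ((j : ℕ) : ℝ) + 1) * η
    have : ((i : ℕ) : ℝ) < ((j : ℕ) : ℝ) := by exact_mod_cast hij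
    nlinarith
  set cc : Fin (K + 1) → ℝ := fun l => (-1) ^ (l : ℕ) * (genVandermonde r (d ∘ l.succAbove)).det with hcc
  -- the fewnomial `φ(y) = ∑ l, y^(d l) cc_l` is the Vandermonde determinant with first node `y`
  have hφ : ∀ y : ℝ, ∑ l, y ^ d l * cc l = (genVandermonde (Fin.cons y r : Fin (K + 1) → ℝ) d).det := fun y => by
    rw [det_genVandermonde_cons]
  -- its sign at `x₀ + 2cη` (`c ≤ K`) is `(-1)^c`, and it is positive on `(0, x₀]`
  have hφnew : ∀ c : ℕ, c ≤ K → 0 < (-1 : ℝ) ^ c * ∑ l, (x₀ + 2 * (c : ℝ) * η) ^ d l * cc l := by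
    intro c hc
    rw [hφ]
    refine genVandermonde_cons_sign r hrmono hrpos d hd _ ?_ c hc ?_ ?_
    · exact add_pos_of_pos_of_nonneg hx₀pos (mul_nonneg (mul_nonneg zero_le_two (Nat.cast_nonneg c)) hηpos.le)
    · intro i hi
      show x₀ + (2 * ((i : ℕ) : ℝ) + 1) * η < x₀ + 2 * (c : ℝ) * η
      have : 2 * ((i : ℕ) : ℝ) + 1 < 2 * (c : ℝ) := by exact_mod_cast (by omega : 2 * (i : ℕ) + 1 < 2 * c)
      nlinarith
    · intro i hi
      show x₀ + 2 * (c : ℝ) * η < x₀ + (2 * ((i : ℕ) : ℝ) + 1) * η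
      have : 2 * (c : ℝ) < 2 * ((i : ℕ) : ℝ) + 1 := by exact_mod_cast (by omega : 2 * c < 2 * (i : ℕ) + 1)
      nlinarith
  have hφold : ∀ y : ℝ, 0 < y → y ≤ x₀ → 0 < ∑ l, y ^ d l * cc l := by
    intro y hy hyle
    have h := genVandermonde_cons_sign r hrmono hrpos d hd y hy 0 (Nat.zero_le K)
      (fun i hi => absurd hi (Nat.not_lt_zero _)) (fun i _ => hyle.trans_lt (hrgt i))
    rw [pow_zero, one_mul, ← hφ] at h
    exact h
  -- the bordered letters
  set S' : Fin (K + 1) → Matrix (Fin (m + 1)) (Fin (m + 1)) ℝ := fun l =>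
    Matrix.reindex finSumFinEquiv finSumFinEquiv
      (Matrix.fromBlocks (S l) 0 0 (cc l • (1 : Matrix (Fin 1) (Fin 1) ℝ))) with hS'
  have hdet' : ∀ y : ℝ, (∑ l, y ^ d l • S' l).det = (∑ l, y ^ d l • S l).det * ∑ l, y ^ d l * cc l :=
    fun y => det_border_eval (fun l => y ^ d l) S cc
  -- new test points and carriers
  set τ' : Fin (N + K + 1) → ℝ := fun j =>
    if h : (j : ℕ) ≤ N then τ ⟨j, Nat.lt_succ_of_le h⟩ else x₀ + 2 * (((j : ℕ) - N : ℕ) : ℝ) * η with hτ'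
  set s : Fin (N + K + 1) → ℝ := fun j =>
    if h : (j : ℕ) ≤ N then (∑ l, τ ⟨j, Nat.lt_succ_of_le h⟩ ^ d l • S l).det
    else (-1) ^ ((j : ℕ) - N) * Δ with hs
  have hτ'_old : ∀ (j : Fin (N + K + 1)) (h : (j : ℕ) ≤ N), τ' j = τ ⟨j, Nat.lt_succ_of_le h⟩ :=
    fun j h => by simp only [hτ', dif_pos h]
  have hτ'_new : ∀ (j : Fin (N + K + 1)), ¬ (j : ℕ) ≤ N → τ' j = x₀ + 2 * (((j : ℕ) - N : ℕ) : ℝ) * η :=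
    fun j h => by simp only [hτ', dif_neg h]
  have hs_old : ∀ (j : Fin (N + K + 1)) (h : (j : ℕ) ≤ N),
      s j = (∑ l, τ ⟨j, Nat.lt_succ_of_le h⟩ ^ d l • S l).det :=
    fun j h => by simp only [hs, dif_pos h]
  have hs_new : ∀ (j : Fin (N + K + 1)), ¬ (j : ℕ) ≤ N → s j = (-1) ^ ((j : ℕ) - N) * Δ :=
    fun j h => by simp only [hs, dif_neg h]
  -- (F1) the carriers carry the signs (exactly)
  have hF1 : ∀ j : Fin (N + K + 1), 0 < (∑ l, τ' j ^ d l • S' l).det * s j := by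
    intro j
    rw [hdet']
    by_cases h : (j : ℕ) ≤ N
    · rw [hτ'_old j h, hs_old j h]
      have hle : τ ⟨j, Nat.lt_succ_of_le h⟩ ≤ x₀ := hτ.monotone (Fin.le_last _)
      have h1 := hφold _ (hpos _) hle
      have h2 : 0 < (∑ l, τ ⟨j, Nat.lt_succ_of_le h⟩ ^ d l • S l).det *
          (∑ l, τ ⟨j, Nat.lt_succ_of_le h⟩ ^ d l • S l).det := mul_self_pos.mpr (hne _)
      have : (∑ l, τ ⟨j, Nat.lt_succ_of_le h⟩ ^ d l • S l).det * (∑ l, τ ⟨j, Nat.lt_succ_of_le h⟩ ^ d l * cc l) *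
          (∑ l, τ ⟨j, Nat.lt_succ_of_le h⟩ ^ d l • S l).det
          = (∑ l, τ ⟨j, Nat.lt_succ_of_le h⟩ ^ d l * cc l) *
            ((∑ l, τ ⟨j, Nat.lt_succ_of_le h⟩ ^ d l • S l).det * (∑ l, τ ⟨j, Nat.lt_succ_of_le h⟩ ^ d l • S l).det) := by
        ring
      rw [this]
      exact mul_pos h1 h2
    · rw [hτ'_new j h, hs_new j h]
      set c : ℕ := (j : ℕ) - N with hc
      have hcK : c ≤ K := by have := j.isLt; omega
      have h1 := hφnew c hcK
      have hdist : dist (x₀ + 2 * (c : ℝ) * η) x₀ < ε := by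
        have h2c : 0 ≤ 2 * (c : ℝ) * η := mul_nonneg (mul_nonneg zero_le_two (Nat.cast_nonneg c)) hηpos.le
        rw [Real.dist_eq, add_sub_cancel_left, abs_of_nonneg h2c]
        have : (c : ℝ) ≤ K := by exact_mod_cast hcK
        nlinarith
      have h2 := hball hdist
      have : (∑ l, (x₀ + 2 * (c : ℝ) * η) ^ d l • S l).det * (∑ l, (x₀ + 2 * (c : ℝ) * η) ^ d l * cc l) *
          ((-1) ^ c * Δ)
          = ((-1) ^ c * ∑ l, (x₀ + 2 * (c : ℝ) * η) ^ d l * cc l) *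
            ((∑ l, (x₀ + 2 * (c : ℝ) * η) ^ d l • S l).det * Δ) := by ring
      rw [this]
      exact mul_pos h1 h2
  -- (F2) consecutive carriers have opposite signs
  have hF2 : ∀ j : Fin (N + K), s j.castSucc * s j.succ < 0 := by
    intro j
    have hc : ((Fin.castSucc j : Fin (N + K + 1)) : ℕ) = j := rfl
    have hsu : ((Fin.succ j : Fin (N + K + 1)) : ℕ) = j + 1 := rfl
    by_cases h1 : (j : ℕ) + 1 ≤ N
    · rw [hs_old _ (by rw [hc]; omega), hs_old _ (by rw [hsu]; exact h1)]
      have := halt ⟨j, by omega⟩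
      convert this using 3 <;> simp
    · by_cases h2 : (j : ℕ) ≤ N
      · have hjN : (j : ℕ) = N := by omega
        rw [hs_old _ (by rw [hc]; exact h2), hs_new _ (by rw [hsu]; omega)]
        have hxN : τ ⟨(Fin.castSucc j : ℕ), Nat.lt_succ_of_le (by rw [hc]; exact h2)⟩ = x₀ := by
          rw [hx₀]; congr 1; ext; simp [hjN]
        rw [hxN, ← hΔ, show ((Fin.succ j : ℕ) - N : ℕ) = 1 by rw [hsu]; omega, pow_one]
        have : 0 < Δ * Δ := mul_self_pos.mpr hΔne
        linarith
      · rw [hs_new _ (by rw [hc]; exact h2), hs_new _ (by rw [hsu]; omega),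
          show ((Fin.succ j : ℕ) - N : ℕ) = ((Fin.castSucc j : ℕ) - N : ℕ) + 1 by rw [hsu, hc]; omega, pow_succ]
        have : 0 < ((-1 : ℝ) ^ ((Fin.castSucc j : ℕ) - N) * Δ) * ((-1 : ℝ) ^ ((Fin.castSucc j : ℕ) - N) * Δ) :=
          mul_self_pos.mpr (mul_ne_zero (pow_ne_zero _ (by norm_num)) hΔne)
        linarith
  -- assemble
  refine ⟨S', τ', fun l => isSymm_border (S l) (hS l) (cc l), ?_, ?_, fun j h0 => ?_,
    fun j => mul_neg_of_carriers (hF1 _) (hF1 _) (hF2 j)⟩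
  · -- strict monotonicity of the test points
    refine Fin.strictMono_iff_lt_succ.mpr fun j => ?_
    have hc : ((Fin.castSucc j : Fin (N + K + 1)) : ℕ) = j := rfl
    have hsu : ((Fin.succ j : Fin (N + K + 1)) : ℕ) = j + 1 := rfl
    by_cases h1 : (j : ℕ) + 1 ≤ N
    · rw [hτ'_old _ (by rw [hc]; omega), hτ'_old _ (by rw [hsu]; exact h1)]
      exact hτ (Fin.mk_lt_mk.mpr (by rw [hc, hsu]; exact Nat.lt_succ_self _))
    · by_cases h2 : (j : ℕ) ≤ N
      · have hjN : (j : ℕ) = N := by omega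
        rw [hτ'_old _ (by rw [hc]; exact h2), hτ'_new _ (by rw [hsu]; omega)]
        have hxN : τ ⟨(Fin.castSucc j : ℕ), Nat.lt_succ_of_le (by rw [hc]; exact h2)⟩ = x₀ := by
          rw [hx₀]; congr 1; ext; simp [hjN]
        rw [hxN, show ((Fin.succ j : ℕ) - N : ℕ) = 1 by rw [hsu]; omega]
        push_cast
        linarith
      · rw [hτ'_new _ (by rw [hc]; exact h2), hτ'_new _ (by rw [hsu]; omega),
          show ((Fin.succ j : ℕ) - N : ℕ) = ((Fin.castSucc j : ℕ) - N : ℕ) + 1 by rw [hsu, hc]; omega]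
        push_cast
        nlinarith
  · -- positivity of the test points
    intro j
    by_cases h : (j : ℕ) ≤ N
    · rw [hτ'_old j h]; exact hpos _
    · rw [hτ'_new j h]
      exact add_pos_of_pos_of_nonneg hx₀pos (mul_nonneg (mul_nonneg zero_le_two (Nat.cast_nonneg _)) hηpos.le)
  · -- nonvanishing (from the carried sign)
    have h := hF1 j
    rw [h0, zero_mul] at h
    exact lt_irrefl 0 h

/-- Transport of a fixed-support alternation certificate along an equality of alternation counts (bookkeeping). [folklore] -/
theorem alternating_transport_support {m K N₁ N₂ : ℕ} (d : Fin K → ℕ) (hN : N₁ = N₂)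
    (h : ∃ (S : Fin K → Matrix (Fin m) (Fin m) ℝ) (τ : Fin (N₁ + 1) → ℝ),
      (∀ l, (S l).IsSymm) ∧ StrictMono τ ∧ (∀ j, 0 < τ j) ∧ (∀ j, (∑ l, τ j ^ d l • S l).det ≠ 0) ∧
      ∀ j : Fin N₁, (∑ l, τ j.castSucc ^ d l • S l).det * (∑ l, τ j.succ ^ d l • S l).det < 0) :
    ∃ (S : Fin K → Matrix (Fin m) (Fin m) ℝ) (τ : Fin (N₂ + 1) → ℝ),
      (∀ l, (S l).IsSymm) ∧ StrictMono τ ∧ (∀ j, 0 < τ j) ∧ (∀ j, (∑ l, τ j ^ d l • S l).det ≠ 0) ∧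
      ∀ j : Fin N₂, (∑ l, τ j.castSucc ^ d l • S l).det * (∑ l, τ j.succ ^ d l • S l).det < 0 := by
  subst hN
  exact h

/-- **THE BORDERING LAW, iterated**: on a strictly increasing support with `K+1` letters, `i` further rows/columns buy `i·K` further
alternations — `ζ(m+i, K+1) ≥ ζ_alt(m, K+1) + i·K`. [folklore] -/
theorem exists_alternating_border_add {m K N : ℕ} (d : Fin (K + 1) → ℕ) (hd : StrictMono d)
    (h : ∃ (S : Fin (K + 1) → Matrix (Fin m) (Fin m) ℝ) (τ : Fin (N + 1) → ℝ),
      (∀ l, (S l).IsSymm) ∧ StrictMono τ ∧ (∀ j, 0 < τ j) ∧ (∀ j, (∑ l, τ j ^ d l • S l).det ≠ 0) ∧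
      ∀ j : Fin N, (∑ l, τ j.castSucc ^ d l • S l).det * (∑ l, τ j.succ ^ d l • S l).det < 0) (i : ℕ) :
    ∃ (S : Fin (K + 1) → Matrix (Fin (m + i)) (Fin (m + i)) ℝ) (τ : Fin (N + i * K + 1) → ℝ),
      (∀ l, (S l).IsSymm) ∧ StrictMono τ ∧ (∀ j, 0 < τ j) ∧ (∀ j, (∑ l, τ j ^ d l • S l).det ≠ 0) ∧
      ∀ j : Fin (N + i * K), (∑ l, τ j.castSucc ^ d l • S l).det * (∑ l, τ j.succ ^ d l • S l).det < 0 := by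
  induction i with
  | zero => exact alternating_transport_support d (by simp) h
  | succ i ih =>
    obtain ⟨S, τ, hS, hτ, hpos, hne, halt⟩ := ih
    obtain ⟨S', τ', hS', hτ', hpos', hne', halt'⟩ := exists_alternating_border d hd S hS τ hτ hpos hne halt
    exact alternating_transport_support d (by ring) ⟨S', τ', hS', hτ', hpos', hne', halt'⟩

open Summit.ValiantsHypothesis.ValiantsHypothesis.Theorems.MatrixDescartes.Negative (PosRootLawAt)

/-- **Certificate ⇒ bordered rows (for the census generator).**  The hypotheses of the tree's `Census.not_posRootLawAt_of_certificate`
on a STRICTLY INCREASING support with `K+1` letters and `N ≥ 1` alternations give, for every `i`, the row `i` sizes down the column: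
`¬ PosRootLawAt (m + i) (K + 1) (N + i·K − 1)`. [folklore] -/
theorem not_posRootLawAt_border_of_certificate {m K N : ℕ} {d : Fin (K + 1) → ℕ} (hd : StrictMono d)
    {S : Fin (K + 1) → Matrix (Fin m) (Fin m) ℝ} {q : ℝ → ℝ}
    (hq : ∀ t : ℝ, (∑ l, t ^ d l • S l).det = q t) (hS : ∀ l, (S l).IsSymm)
    (τ : Fin (N + 1) → ℝ) (hτ : StrictMono τ) (hpos : ∀ j, 0 < τ j)
    (halt : ∀ j : Fin N, q (τ j.castSucc) * q (τ j.succ) < 0) (hN : 1 ≤ N) (i : ℕ) :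
    ¬ PosRootLawAt (m + i) (K + 1) (N + i * K - 1) := by
  have halt' : ∀ j : Fin N,
      (∑ l, τ j.castSucc ^ d l • S l).det * (∑ l, τ j.succ ^ d l • S l).det < 0 := fun j => by
    rw [hq, hq]; exact halt j
  have hne : ∀ j, (∑ l, τ j ^ d l • S l).det ≠ 0 :=
    ne_zero_of_alternating hN (fun j => (∑ l, τ j ^ d l • S l).det) halt'
  obtain ⟨S', τ', hS', hτ', hpos', -, halt''⟩ :=
    exists_alternating_border_add d hd ⟨S, τ, hS, hτ, hpos, hne, halt'⟩ i
  exact not_posRootLawAt_of_alternating (hN.trans (Nat.le_add_right N (i * K))) d S' hS' τ' hτ' hpos' halt''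

end Summit.ValiantsHypothesis.ValiantsHypothesis.Theorems.LacunarySymmetroidMatrixDescartes.Census.Graft
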